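import Summits.CriticalPhenomena.PercolationContinuityZ3.Theorems.PercNearOneGluingNoHeavyConstsTwoCopyDownwardFKGPrelims
import HarnessLib

/-!
# The hard-core pair of two downward-FKG laws has positively associated marginals — abstract finite core, part II

Support file (prover prim-facecert gen 14; `--supports stmt-CriticalPhenomena-4575`); builds on the lead seat
prim-nh-lead-4575's gen-105 programme (memo `run/shared/lean/prim/prim-nh-lead-4575/LEAD-GEN105.md` §1(6): conjecture (HC)
"hard-core Harris", its reduction to PA-BERN = `Consts.FibrewiseBHK`, and the pencil proof of the MEASURE-LEVEL two-copy
statement by an averaging-operator iteration; `|N| = 1` in the kernel: `…ConstsHardCoreHarrisOne`).  No definitions, no named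
facts, no sorries; standard axioms.

THEOREM (`TwoCopyHardCore.assoc`, this file).  In the setting of part I (`…ConstsTwoCopyDownwardFKGPrelims`): finite preordered
`α, β`, weights `p, p' ≥ 0`, a `0/1` kernel `κ` antitone in each argument, BOTH copies conditionally positively associated given
each partner (`hPA₀`, `hPA₁` — "downward FKG"), and each copy having a bottom set of positive weight compatible with every
partner.  Then under the pair weight `p a · p' b · κ a b` monotone functions of the copy-0 coordinate are positively correlated:
`(ΣΣ pp'κ·F a)(ΣΣ pp'κ·G a) ≤ (ΣΣ pp'κ)(ΣΣ pp'κ·F a·G a)`.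
In words: the law of a downward-FKG random set CONDITIONED TO AVOID AN INDEPENDENT downward-FKG random set is associated.
(Liggett asks whether downward FKG implies "downward conditional association" = association of every tilt by a decreasing
log-supermodular `h`; the tilt here, `h(Z) = P(Z' ∩ Z = ∅)`, is such an `h`, so this is a case of that implication.)

PROOF.  `Φ₀(F,G) ≥ Φ₁(TF,TG) ≥ Φ₀(T'TF,T'TG) ≥ … ` (the averaging `step` in both directions; `T` flips monotonicity, so the
pairs stay comonotone), the iterates `(T'T)ⁿF` have oscillation `≤ rⁿ·osc F` with `r = (1−δ₀)(1−δ₁) < 1` (Doeblin,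
`transfer_contract`), and `|Φ₀(h,k)| ≤ ½Q²·osc h·osc k` (`cov_ge_neg`); let `n → ∞`.  This is the T-iteration of
LEAD-GEN105 §1(6) with the limit made explicit.  [this work]
-/

namespace Summit.CriticalPhenomena.PercolationContinuityZ3.Theorems

namespace TwoCopyHardCore

open Finset

variable {α β : Type*} [Fintype α] [Fintype β]

section TwoCopies

variable [Preorder α] [Preorder β]

/-- **Two-copy positive association (abstract "hard-core pair of downward-FKG laws").**
Two finite (pre)ordered types `α, β` carry nonnegative weights `p, p'` and a `0/1` compatibility kernel `κ`
which is antitone in each argument; copy 0 is *conditionally positively associated given each partner*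
(`hPA₀`: under the weights `p a · κ a b`, monotone functions of `a` are positively correlated, for every `b`)
and so is copy 1 (`hPA₁`), and each copy has a *bottom* of positive weight compatible with everything.  Then,
under the pair weight `p a · p' b · κ a b`, monotone functions of the copy-0 coordinate are positively correlated:
`(ΣΣ pp'κ·F a)(ΣΣ pp'κ·G a) ≤ (ΣΣ pp'κ)(ΣΣ pp'κ·F a G a)`.
Proof: the averaging step (`step`) in both directions, the monotonicity flips (`transfer_antitone`,
`transfer_monotone`), the Doeblin contraction (`transfer_contract`) and `cov_ge_neg`; letting the number of
double steps tend to infinity.  [this work; the measure-level two-copy argument of prim-nh-lead-4575 LEAD-GEN105 §1(6),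
made abstract; "downward FKG" is the terminology of Liggett–Steif / van den Berg–Häggström–Kahn; the theorem is a case of
Liggett's question "downward FKG ⇒ downward conditionally associated?"]
[cite: Liggett2006ConditionalAssociation, §1 display (1.7) and the paragraph after it (downward FKG, DCA)]
[cite: VandenbergHaggstromKahn2005, Thm. 1.3 (p. 6) and proof of Thm. 1.5 (pp. 7–8)] -/
theorem assoc (p : α → ℝ) (p' : β → ℝ) (κ : α → β → ℝ)
    (hp : ∀ a, 0 ≤ p a) (hp' : ∀ b, 0 ≤ p' b)
    (hκ01 : ∀ a b, κ a b = 0 ∨ κ a b = 1)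
    (hκa : ∀ b, Antitone (fun a => κ a b)) (hκb : ∀ a, Antitone (κ a))
    (hPA₀ : ∀ b (F G : α → ℝ), Monotone F → Monotone G →
      (∑ a, p a * κ a b * F a) * (∑ a, p a * κ a b * G a) ≤
        (∑ a, p a * κ a b) * (∑ a, p a * κ a b * (F a * G a)))
    (hPA₁ : ∀ a (F G : β → ℝ), Monotone F → Monotone G →
      (∑ b, p' b * κ a b * F b) * (∑ b, p' b * κ a b * G b) ≤
        (∑ b, p' b * κ a b) * (∑ b, p' b * κ a b * (F b * G b)))
    (B₀ : Finset α) (hB₀ : ∀ a ∈ B₀, ∀ b, κ a b = 1) (hB₀pos : 0 < ∑ a ∈ B₀, p a)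
    (B₁ : Finset β) (hB₁ : ∀ b ∈ B₁, ∀ a, κ a b = 1) (hB₁pos : 0 < ∑ b ∈ B₁, p' b)
    (F G : α → ℝ) (hF : Monotone F) (hG : Monotone G) :
    (∑ a, ∑ b, p a * p' b * κ a b * F a) * (∑ a, ∑ b, p a * p' b * κ a b * G a) ≤
      (∑ a, ∑ b, p a * p' b * κ a b) * (∑ a, ∑ b, p a * p' b * κ a b * (F a * G a)) := by
  classical
  have hκ0 : ∀ a b, 0 ≤ κ a b := fun a b => by rcases hκ01 a b with h | h <;> norm_num [h]
  have hκ1 : ∀ a b, κ a b ≤ 1 := fun a b => by rcases hκ01 a b with h | h <;> norm_num [h]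
  -- the transposed kernel
  have hκ01' : ∀ b a, (fun b a => κ a b) b a = 0 ∨ (fun b a => κ a b) b a = 1 := fun b a => hκ01 a b
  have hκa' : ∀ a, Antitone (fun b => (fun b a => κ a b) b a) := fun a => hκb a
  have hκb' : ∀ b, Antitone ((fun b a => κ a b) b) := fun b => hκa b
  -- masses of compatible partners
  set m₀ : β → ℝ := fun b => ∑ a, p a * κ a b with hm₀def
  set m₁ : α → ℝ := fun a => ∑ b, p' b * κ a b with hm₁def
  have hm₀ : ∀ b, m₀ b = ∑ a, p a * κ a b := fun b => rfl
  have hm₁ : ∀ a, m₁ a = ∑ b, p' b * (fun b a => κ a b) b a := fun a => rfl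
  have hm₀pos : ∀ b, 0 < m₀ b := by
    intro b
    calc (0 : ℝ) < ∑ a ∈ B₀, p a := hB₀pos
      _ = ∑ a ∈ B₀, p a * κ a b := Finset.sum_congr rfl fun a ha => by rw [hB₀ a ha b, mul_one]
      _ ≤ ∑ a, p a * κ a b :=
          Finset.sum_le_sum_of_subset_of_nonneg (Finset.subset_univ _) fun a _ _ => mul_nonneg (hp a) (hκ0 a b)
  have hm₁pos : ∀ a, 0 < m₁ a := by
    intro a
    calc (0 : ℝ) < ∑ b ∈ B₁, p' b := hB₁pos
      _ = ∑ b ∈ B₁, p' b * κ a b := Finset.sum_congr rfl fun b hb => by rw [hB₁ b hb a, mul_one]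
      _ ≤ ∑ b, p' b * κ a b :=
          Finset.sum_le_sum_of_subset_of_nonneg (Finset.subset_univ _) fun b _ _ => mul_nonneg (hp' b) (hκ0 a b)
  -- the two marginals of the pair weight and the total mass
  set ν₀ : α → ℝ := fun a => ∑ b, p a * p' b * κ a b with hν₀def
  set ν₁ : β → ℝ := fun b => ∑ a, p a * p' b * κ a b with hν₁def
  have hν₀ : ∀ a, ν₀ a = ∑ b, p a * p' b * κ a b := fun a => rfl
  have hν₁ : ∀ b, ν₁ b = ∑ a, p a * p' b * κ a b := fun b => rfl
  have hν₁' : ∀ b, ν₁ b = ∑ a, p' b * p a * (fun b a => κ a b) b a :=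
    fun b => Finset.sum_congr rfl fun a _ => by ring
  have hν₀' : ∀ a, ν₀ a = ∑ b, p' b * p a * (fun b a => κ a b) b a :=
    fun a => Finset.sum_congr rfl fun b _ => by ring
  have hν₀0 : ∀ a, 0 ≤ ν₀ a := fun a =>
    Finset.sum_nonneg fun b _ => mul_nonneg (mul_nonneg (hp a) (hp' b)) (hκ0 a b)
  have hν₁0 : ∀ b, 0 ≤ ν₁ b := fun b =>
    Finset.sum_nonneg fun a _ => mul_nonneg (mul_nonneg (hp a) (hp' b)) (hκ0 a b)
  set Q : ℝ := ∑ a, ν₀ a with hQdef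
  have hQ0 : 0 ≤ Q := Finset.sum_nonneg fun a _ => hν₀0 a
  have hQ' : ∑ b, ν₁ b = Q := by
    rw [hQdef]; simp only [hν₀, hν₁]; rw [Finset.sum_comm]
  -- the two averaging operators
  set T : (α → ℝ) → β → ℝ := fun h b => (∑ a, p a * κ a b * h a) / m₀ b with hTdef
  set T' : (β → ℝ) → α → ℝ := fun k a => (∑ b, p' b * κ a b * k b) / m₁ a with hT'def
  have hT : ∀ h b, T h b * m₀ b = ∑ a, p a * κ a b * h a := fun h b => by
    simp only [hTdef]; exact div_mul_cancel₀ _ (ne_of_gt (hm₀pos b))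
  have hT' : ∀ k a, T' k a * m₁ a = ∑ b, p' b * (fun b a => κ a b) b a * k b := fun k a => by
    simp only [hT'def]; exact div_mul_cancel₀ _ (ne_of_gt (hm₁pos a))
  -- the swapped positive-association hypothesis, for antitone pairs
  have hPA₁anti : ∀ a (h k : β → ℝ), Antitone h → Antitone k →
      (∑ b, p' b * (fun b a => κ a b) b a * h b) * (∑ b, p' b * (fun b a => κ a b) b a * k b) ≤
        (∑ b, p' b * (fun b a => κ a b) b a) * (∑ b, p' b * (fun b a => κ a b) b a * (h b * k b)) :=
    fun a h k hh hk => pa_anti_anti (fun b => p' b * κ a b) h k (hPA₁ a) hh hk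
  have hPA₁' : ∀ a (h k : β → ℝ), Monotone h → Monotone k →
      (∑ b, p' b * (fun b a => κ a b) b a * h b) * (∑ b, p' b * (fun b a => κ a b) b a * k b) ≤
        (∑ b, p' b * (fun b a => κ a b) b a) * (∑ b, p' b * (fun b a => κ a b) b a * (h b * k b)) :=
    fun a h k hh hk => hPA₁ a h k hh hk
  -- covariance forms
  set Φ₀ : (α → ℝ) → (α → ℝ) → ℝ := fun h k =>
    Q * (∑ a, ν₀ a * (h a * k a)) - (∑ a, ν₀ a * h a) * (∑ a, ν₀ a * k a) with hΦ₀def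
  set Φ₁ : (β → ℝ) → (β → ℝ) → ℝ := fun h k =>
    Q * (∑ b, ν₁ b * (h b * k b)) - (∑ b, ν₁ b * h b) * (∑ b, ν₁ b * k b) with hΦ₁def
  -- one averaging step in each direction
  have step₀ : ∀ h k : α → ℝ, Monotone h → Monotone k → Φ₁ (T h) (T k) ≤ Φ₀ h k := by
    intro h k hh hk
    simp only [hΦ₀def, hΦ₁def]
    exact step p p' κ h k ν₀ ν₁ m₀ (T h) (T k) (T (fun a => h a * k a)) Q hQ0 hν₁0 hν₀ hν₁ hm₀ hm₀pos
      (hT h) (hT k) (hT _) (fun b => hPA₀ b h k hh hk)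
  have step₁ : ∀ h k : β → ℝ, Antitone h → Antitone k → Φ₀ (T' h) (T' k) ≤ Φ₁ h k := by
    intro h k hh hk
    simp only [hΦ₀def, hΦ₁def]
    exact step p' p (fun b a => κ a b) h k ν₁ ν₀ m₁ (T' h) (T' k) (T' (fun b => h b * k b)) Q hQ0 hν₀0
      hν₁' hν₀' hm₁ hm₁pos (hT' h) (hT' k) (hT' _) (fun a => hPA₁anti a h k hh hk)
  -- monotonicity flips
  have flip₀ : ∀ h : α → ℝ, Monotone h → Antitone (T h) := fun h hh =>
    transfer_antitone p κ h m₀ (T h) hκ01 hκa hκb hm₀ hm₀pos (hT h) hPA₀ hh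
  have flip₁ : ∀ k : β → ℝ, Antitone k → Monotone (T' k) := fun k hk =>
    transfer_monotone p' (fun b a => κ a b) k m₁ (T' k) hκ01' hκa' hκb' hm₁ hm₁pos (hT' k) hPA₁' hk
  -- contraction constants
  have hM₀ : 0 < ∑ a, p a := lt_of_lt_of_le hB₀pos
    (Finset.sum_le_sum_of_subset_of_nonneg (Finset.subset_univ B₀) fun a _ _ => hp a)
  have hM₁ : 0 < ∑ b, p' b := lt_of_lt_of_le hB₁pos
    (Finset.sum_le_sum_of_subset_of_nonneg (Finset.subset_univ B₁) fun b _ _ => hp' b)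
  set δ₀ : ℝ := (∑ a ∈ B₀, p a) / ∑ a, p a with hδ₀def
  set δ₁ : ℝ := (∑ b ∈ B₁, p' b) / ∑ b, p' b with hδ₁def
  have hδ₀pos : 0 < δ₀ := div_pos hB₀pos hM₀
  have hδ₀le : δ₀ ≤ 1 := div_le_one_of_le₀
    (Finset.sum_le_sum_of_subset_of_nonneg (Finset.subset_univ B₀) fun a _ _ => hp a) hM₀.le
  have hδ₁pos : 0 < δ₁ := div_pos hB₁pos hM₁
  have hδ₁le : δ₁ ≤ 1 := div_le_one_of_le₀
    (Finset.sum_le_sum_of_subset_of_nonneg (Finset.subset_univ B₁) fun b _ _ => hp' b) hM₁.le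
  set r : ℝ := (1 - δ₁) * (1 - δ₀) with hrdef
  have hr0 : 0 ≤ r := mul_nonneg (by linarith) (by linarith)
  have hr1 : r < 1 := mul_lt_one_of_nonneg_of_lt_one_left (by linarith) (by linarith) (by linarith)
  have contr₀ : ∀ (h : α → ℝ) (D : ℝ), (∀ a a', h a - h a' ≤ D) →
      ∀ b b', T h b - T h b' ≤ (1 - δ₀) * D := fun h D hD =>
    transfer_contract p κ h m₀ (T h) B₀ D hp hκ0 hκ1 hB₀ hB₀pos hm₀ hm₀pos (hT h) hD
  have contr₁ : ∀ (k : β → ℝ) (D : ℝ), (∀ b b', k b - k b' ≤ D) →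
      ∀ a a', T' k a - T' k a' ≤ (1 - δ₁) * D := fun k D hD =>
    transfer_contract p' (fun b a => κ a b) k m₁ (T' k) B₁ D hp' (fun b a => hκ0 a b) (fun b a => hκ1 a b)
      hB₁ hB₁pos hm₁ hm₁pos (hT' k) hD
  -- oscillations of `F`, `G`
  set DF : ℝ := 2 * ∑ a, |F a| with hDFdef
  set DG : ℝ := 2 * ∑ a, |G a| with hDGdef
  have hosc : ∀ (X : α → ℝ) (a a' : α), X a - X a' ≤ 2 * ∑ a, |X a| := by
    intro X a a'
    have h1 : |X a| ≤ ∑ a, |X a| :=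
      Finset.single_le_sum (f := fun a => |X a|) (fun a _ => abs_nonneg _) (Finset.mem_univ a)
    have h2 : |X a'| ≤ ∑ a, |X a| :=
      Finset.single_le_sum (f := fun a => |X a|) (fun a _ => abs_nonneg _) (Finset.mem_univ a')
    linarith [le_abs_self (X a), neg_abs_le (X a')]
  have hDF : ∀ a a', F a - F a' ≤ DF := fun a a' => hosc F a a'
  have hDG : ∀ a a', G a - G a' ≤ DG := fun a a' => hosc G a a'
  -- the double step and its iterates
  set U : (α → ℝ) → (α → ℝ) := fun h => T' (T h) with hUdef
  have iter : ∀ n : ℕ, Monotone (U^[n] F) ∧ Monotone (U^[n] G) ∧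
      (∀ a a', (U^[n] F) a - (U^[n] F) a' ≤ r ^ n * DF) ∧
      (∀ a a', (U^[n] G) a - (U^[n] G) a' ≤ r ^ n * DG) ∧
      Φ₀ (U^[n] F) (U^[n] G) ≤ Φ₀ F G := by
    intro n
    induction n with
    | zero =>
      simp only [Function.iterate_zero, id_eq, pow_zero, one_mul]
      exact ⟨hF, hG, hDF, hDG, le_rfl⟩
    | succ n ih =>
      obtain ⟨h1, h2, h3, h4, h5⟩ := ih
      simp only [Function.iterate_succ_apply']
      have hUF : U (U^[n] F) = T' (T (U^[n] F)) := rfl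
      have hUG : U (U^[n] G) = T' (T (U^[n] G)) := rfl
      rw [hUF, hUG]
      refine ⟨flip₁ _ (flip₀ _ h1), flip₁ _ (flip₀ _ h2), ?_, ?_, ?_⟩
      · intro a a'
        calc T' (T (U^[n] F)) a - T' (T (U^[n] F)) a'
            ≤ (1 - δ₁) * ((1 - δ₀) * (r ^ n * DF)) := contr₁ _ _ (contr₀ _ _ h3) a a'
          _ = r ^ (n + 1) * DF := by rw [pow_succ, hrdef]; ring
      · intro a a'
        calc T' (T (U^[n] G)) a - T' (T (U^[n] G)) a'
            ≤ (1 - δ₁) * ((1 - δ₀) * (r ^ n * DG)) := contr₁ _ _ (contr₀ _ _ h4) a a'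
          _ = r ^ (n + 1) * DG := by rw [pow_succ, hrdef]; ring
      · calc Φ₀ (T' (T (U^[n] F))) (T' (T (U^[n] G)))
            ≤ Φ₁ (T (U^[n] F)) (T (U^[n] G)) := step₁ _ _ (flip₀ _ h1) (flip₀ _ h2)
          _ ≤ Φ₀ (U^[n] F) (U^[n] G) := step₀ _ _ h1 h2
          _ ≤ Φ₀ F G := h5
  -- a lower bound at every stage
  have lower : ∀ n : ℕ, -(1 / 2 * Q ^ 2 * DF * DG * (r ^ 2) ^ n) ≤ Φ₀ F G := by
    intro n
    obtain ⟨_, _, h3, h4, h5⟩ := iter n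
    have hcov := cov_ge_neg ν₀ (U^[n] F) (U^[n] G) (r ^ n * DF) (r ^ n * DG) hν₀0 h3 h4
    have e : 1 / 2 * (∑ a, ν₀ a) ^ 2 * (r ^ n * DF) * (r ^ n * DG) =
        1 / 2 * Q ^ 2 * DF * DG * (r ^ 2) ^ n := by
      rw [hQdef, ← pow_mul, mul_comm 2 n, pow_mul]; ring
    rw [e] at hcov
    have hΦn : Φ₀ (U^[n] F) (U^[n] G) =
        (∑ a, ν₀ a) * (∑ a, ν₀ a * ((U^[n] F) a * (U^[n] G) a)) -
          (∑ a, ν₀ a * (U^[n] F) a) * (∑ a, ν₀ a * (U^[n] G) a) := by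
      simp only [hΦ₀def, hQdef]
    linarith [hcov, h5, hΦn]
  -- hence `Φ₀ F G ≥ 0`
  have main : 0 ≤ Φ₀ F G := by
    by_contra hneg
    push Not at hneg
    set C : ℝ := 1 / 2 * Q ^ 2 * DF * DG with hCdef
    have hDF0 : 0 ≤ DF := by have := hDF; rcases isEmpty_or_nonempty α with hα | ⟨⟨a⟩⟩
                             · simp [hDFdef]
                             · linarith [hDF a a]
    have hDG0 : 0 ≤ DG := by rcases isEmpty_or_nonempty α with hα | ⟨⟨a⟩⟩
                             · simp [hDGdef]
                             · linarith [hDG a a]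
    have hC0 : 0 ≤ C := by positivity
    rcases hC0.eq_or_lt with hC | hC
    · have h0 := lower 0
      rw [← hC] at h0
      simp only [zero_mul, neg_zero] at h0
      linarith
    · have hr2 : r ^ 2 < 1 := by nlinarith
      obtain ⟨n, hn⟩ := exists_pow_lt_of_lt_one (div_pos (neg_pos.2 hneg) hC) hr2
      have h2 : C * (r ^ 2) ^ n < -Φ₀ F G := by
        rw [lt_div_iff₀ hC] at hn; linarith
      linarith [lower n]
  -- unfold the covariance form
  have eX : ∀ X : α → ℝ, ∑ a, ∑ b, p a * p' b * κ a b * X a = ∑ a, ν₀ a * X a :=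
    fun X => Finset.sum_congr rfl fun a _ => by rw [hν₀ a, Finset.sum_mul]
  rw [eX F, eX G, eX (fun a => F a * G a)]
  have hΦ : Φ₀ F G = Q * (∑ a, ν₀ a * (F a * G a)) - (∑ a, ν₀ a * F a) * (∑ a, ν₀ a * G a) := rfl
  linarith [main, hΦ]

end TwoCopies

end TwoCopyHardCore

end Summit.CriticalPhenomena.PercolationContinuityZ3.Theorems
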